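import Summits.QuantumFields.BalabanUV.Beta.FP.PerfectStencilStep
import Summits.QuantumFields.BalabanUV.Beta.FP.LetterInheritance
import Summits.QuantumFields.BalabanUV.Beta.GAN24.SrecLinearPartEq

/-!
# `BalabanUV.Beta.FP.PerfectStencilFixedPoint` — road «FP» for binder row D1, row **N1-J∞-S** (second half, `LEAVES-FP.md` l.547; owner d1-p3 gen 12):
# THE PERFECT ACTION STENCIL IS A FIXED POINT OF THE RESCALED RECURSION STEP — `S∞ = Φ_S(S∞; G∞, K₁, K₁)` for
# `S∞ := limStOf (j ↦ unitS_j (SrecOf V H G cE cVH cΛ j))`, by entrywise limits in `PerfectStencilStep.unitS_SrecOf_succ`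

HONEST DEPENDENCY (page 1, mandatory): continuum YM on T⁴ ⇐ BetaPertH ∧ nine spine estimates (0/9 proved); BetaPertH ⇐ (D1) ∧ (D4) ∧ CAP+tail;
G-an2-4 gates asym, D1 and NE2/3/4.  HONEST FRAMING (cell contract, verbatim): «discharging `BetaPertH` makes Bałaban's UV stability UNCONDITIONAL —
a real constructive-QFT result; it is NOT the continuum limit and NOT the Clay problem.»  ABSOLUTE RULE (cell, verbatim): «No internally-minted
statement may enter as a cited fact. Every hypothesis is either kernel-proved in this package or a verbatim quotation of a PUBLISHED theorem with page
reference.»  Nothing is cited; no `def`, no `def … : Prop`; no wall binder instantiated; no existing file touched.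

NOT IN PRINT; OUR BOOKKEEPING — [folklore] Tannery ∕ Lipschitz passages over the tree's currencies BY NAME: leaf-05's `ThirdJetKernel.biLoc_e3K_sub` ∕
`locStencil_e3K` and leaf-01's `SrecLinearPartEq.e3K_add` (cubic term), an2's `BalabanStepJetsSucc.abs_lamCoeffK_le` + the owner's
`LetterInheritance.tendsto_comp_of_rate` + Mathlib's `tendsto_tsum_of_dominated_convergence` (Lagrange term), asym1's `HessKerDressedLimit.locStencil_limStOf` ∕
`locStencil_sub_limStOf` ∕ `tendsto_of_biLoc_rate` (the constructed limit and its rate).  EVERY analytic input is a DISPLAYED binder: the (CONV-C)-S rows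
`hS0 hSall0` in the END's currency (uniform `LocStencil` + geometric `LocStencil`-Cauchy data of the unit-rescaled family), the K-slot and the G-slot in
`BiVertexLimit`'s rate currency (`Decays` bound, limit, geometric `Decays`-rate), the block shapes (ShV)(ShH) of `PerfectStencilStep` and a sup bound (LH₀) on
the Hessian table `H`.  Discharges NO (CONV-C) row and NO table letter; NOT N2, NOT D1, NOT `BetaPertH`, NOT continuum, NOT Clay.

## What is proved (generic `d`; `1 ≤ Lc`; one common decay rate `m > 0` and ratio `0 ≤ θ < 1` — currencies are exchanged upstream by monotonicity)
* §1 `e3ShapeConst_mul`; **`biLoc_e3K_pair_sub`** — the cubic functional is LIPSCHITZ IN THE PAIR `(K, S)` (one centre):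
  `BiLoc (e3K K′ L S′ κ u − e3K K L S κ u) u u (e3LipConst·εK + e3ShapeConst(εS)) (m/8)`; **`tendsto_e3K_apply`** — entrywise convergence along rate data.
* §2 **`tendsto_SLam_apply`** (Tannery over the coarse bonds: coefficients dominated by ONE decaying weight and convergent, table sup-bounded);
  `tendsto_lamCoeffK_KStepUnit` — the step multiplier response `lamCoeffK (KStepUnit Lc (j+1)) (mmRead Lc (KStepUnit Lc j)) Lc` converges entrywise to
  `lamCoeffK K₁ (mmRead Lc K₁) Lc` and is dominated uniformly (`abs_lamCoeffK_KStepUnit_le`).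
* §3 **`limStOf_unitS_SrecOf_eq`** — THE FIXED-POINT EQUATION: under (ShV)(ShH)(LH₀), the G-slot and K-slot rate data and `hS0 hSall0`,
  `limStOf S̃ = fun κ u ↦ (cE·Lc^{2(d+1)}) • e3OfK Lc G∞ (limStOf S̃) κ u + cVH • V κ u + (cΛ·Lc^{2(d+1)}) • SLam Lc (lamCoeffK K₁ (mmRead Lc K₁) Lc) H κ u`,
  `S̃ j := unitS (sfStep Lc j) (smStep d Lc j) (SrecOf d Lc V H G cE cVH cΛ j)` — two rate-convergent descriptions of the entry of `S̃ (j+1)` have ONE limit.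
-/

noncomputable section

open Finset Filter Topology
open scoped BigOperators
open Literature.MathematicalPhysics.QuantumFieldTheory
open Literature.MathematicalPhysics.QuantumFieldTheory.Balaban1983to89
open Literature.MathematicalPhysics.QuantumFieldTheory.Balaban1983to89.Beta
open B12Sec2to5 (l1 l1_nonneg)
open ExpKernelCalculus (MKer Decays BiLoc VertexFamily comp Zl Zl_nonneg summable_exp_shift')
open OneStepResolventKernel (Fib LocStencil)
open OneStepKernelFamily (KInvStep)
open InterLevelTransport (SLam cwsum_apply)
open BalabanStepJetsSucc (mmRead lamCoeffK abs_lamCoeffK_le decays_mmRead)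
open KernelWard (biLoc_add bdd_of_biLoc)
open HessKerDressedLimit (limStOf limStOf_apply locStencil_limStOf locStencil_sub_limStOf tendsto_of_biLoc_rate mker_sub_apply)
open Summit.QuantumFields.BalabanUV.Beta.HessKerDressedUnits (unitK unitS)
open Summit.QuantumFields.BalabanUV.Beta.DecayingKernelNeumann (decays_congr_const)
open Summit.QuantumFields.BalabanUV.Beta.GAN24.CombesThomas (sfStep smStep KStepUnit)
open Summit.QuantumFields.BalabanUV.Beta.GAN24.ThirdJetKernel (e3K e3ShapeConst e3LipConst locStencil_e3K biLoc_e3K_sub mmRead_sub)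
open Summit.QuantumFields.BalabanUV.Beta.GAN24.SrecLinearPartEq (e3K_add)
open Summit.QuantumFields.BalabanUV.Beta.GAN24.CubicReadoutDecLift (e3OfK_eq_e3K)
open Summit.QuantumFields.BalabanUV.Beta.FP.LetterInheritance (tendsto_comp_of_rate)
open Summit.QuantumFields.BalabanUV.Beta.SpineRooted (e3OfK)
open Summit.QuantumFields.BalabanUV.Beta.WardLocusRecursive (SrecOf)
open Summit.QuantumFields.BalabanUV.Beta.FP.PerfectStencilStep (unitS_SrecOf_succ)

namespace Summit.QuantumFields.BalabanUV.Beta.FP.PerfectStencilFixedPoint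

variable {d : ℕ}

/-! ## §1 The cubic functional is Lipschitz in the pair `(K, S)`; entrywise convergence along rate data -/

section Cubic

/-- [folklore] The shape constant is linear in the stencil constant. -/
theorem e3ShapeConst_mul (C t Cs δ : ℝ) : e3ShapeConst d C (t * Cs) δ = t * e3ShapeConst d C Cs δ := by
  unfold e3ShapeConst; ring

/-- [folklore] **`e3K` IS LIPSCHITZ IN THE PAIR `(K, S)`** (one centre `u`): kernels decaying at rate `m` with common bound `C` and difference `εK`,
stencils local at rate `m` with common bound `Cs` and difference `εS` ⟹
`BiLoc (e3K K′ L S′ κ u − e3K K L S κ u) u u (e3LipConst d C C Cs m · εK + e3ShapeConst d C εS m) (m/8)`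
(`biLoc_e3K_sub` in the kernel at the new stencil + `e3K_add`/`locStencil_e3K` in the stencil at the old kernel). -/
theorem biLoc_e3K_pair_sub {K K' : MKer (d + 1) (Fib d)} {S S' : Fin (d + 1) → (Fin (d + 1) → ℤ) → MKer (d + 1) (Fib d)}
    {C εK Cs εS m : ℝ} (hK : Decays K C m) (hK' : Decays K' C m) (hKK : Decays (K' - K) εK m)
    (hS : LocStencil S Cs m) (hS' : LocStencil S' Cs m) (hSS : LocStencil (S' - S) εS m) (hm : 0 < m) {L : ℕ} (hL : 1 ≤ L)
    (κ : Fin (d + 1)) (u : Fin (d + 1) → ℤ) :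
    BiLoc (e3K K' L S' κ u - e3K K L S κ u) u u (e3LipConst d C C Cs m * εK + e3ShapeConst d C εS m) (m / 8) := by
  -- in the kernel, at the new stencil
  have h1 : BiLoc (e3K K' L S' κ u - e3K K L S' κ u) u u (e3LipConst d C C Cs m * εK) (m / 8) :=
    biLoc_e3K_sub hK hK' hKK hS' hm le_rfl hL κ u
  -- in the stencil, at the old kernel: additivity on the local class, then the shape of the difference
  have hadd := e3K_add hK hm L hS hSS hm hm κ u
  have hfun : (fun κ u => S κ u + (S' - S) κ u) = S' := by
    funext κ u; simp only [Pi.sub_apply, add_sub_cancel]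
  rw [hfun] at hadd
  have h2 : BiLoc (e3K K L S' κ u - e3K K L S κ u) u u (e3ShapeConst d C εS m) (m / 8) := by
    have h := locStencil_e3K hK hSS hm le_rfl hL κ u
    have e : e3K K L S' κ u - e3K K L S κ u = e3K K L (S' - S) κ u := by rw [hadd]; abel
    rw [e]; exact h
  have e : e3K K' L S' κ u - e3K K L S κ u = (e3K K' L S' κ u - e3K K L S' κ u) + (e3K K L S' κ u - e3K K L S κ u) := by abel
  rw [e]
  exact biLoc_add h1 h2

variable {G : ℕ → MKer (d + 1) (Fib d)} {Ginf : MKer (d + 1) (Fib d)}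
  {S : ℕ → Fin (d + 1) → (Fin (d + 1) → ℤ) → MKer (d + 1) (Fib d)} {Sinf : Fin (d + 1) → (Fin (d + 1) → ℤ) → MKer (d + 1) (Fib d)}
  {C cK Cs cS m θ : ℝ}

/-- [folklore] **ENTRYWISE CONVERGENCE OF THE CUBIC TERM ALONG RATE DATA**: `G j → G∞` at a geometric `Decays`-rate with a uniform bound, `S j → S∞` at a
geometric `LocStencil`-rate with a uniform bound ⟹ `e3K (G j) L (S j) κ u → e3K G∞ L S∞ κ u` entrywise. -/
theorem tendsto_e3K_apply (hG : ∀ j, Decays (G j) C m) (hGinf : Decays Ginf C m) (hGrate : ∀ j, Decays (G j - Ginf) (cK * θ ^ j) m)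
    (hS : ∀ j, LocStencil (S j) Cs m) (hSinf : LocStencil Sinf Cs m) (hSrate : ∀ j, LocStencil (S j - Sinf) (cS * θ ^ j) m)
    (hm : 0 < m) (hθ0 : 0 ≤ θ) (hθ1 : θ < 1) {L : ℕ} (hL : 1 ≤ L) (κ : Fin (d + 1)) (u x z : Fin (d + 1) → ℤ) (a b : Fib d) :
    Tendsto (fun j => e3K (G j) L (S j) κ u x z a b) atTop (𝓝 (e3K Ginf L Sinf κ u x z a b)) := by
  refine tendsto_of_biLoc_rate (T := fun j => e3K (G j) L (S j) κ u) (Tinf := e3K Ginf L Sinf κ u) (p := u) (q := u)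
    (c := e3LipConst d C C Cs m * cK + e3ShapeConst d C cS m) (δ := m / 8) (fun k => ?_) hθ0 hθ1 x z a b
  have h := biLoc_e3K_pair_sub hGinf (hG k) (hGrate k) hSinf (hS k) (hSrate k) hm hL κ u
  rw [mul_comm cS (θ ^ k), e3ShapeConst_mul] at h
  have e : e3LipConst d C C Cs m * (cK * θ ^ k) + θ ^ k * e3ShapeConst d C cS m = (e3LipConst d C C Cs m * cK + e3ShapeConst d C cS m) * θ ^ k := by
    ring
  rw [e] at h
  exact h

end Cubic

/-! ## §2 The Lagrange term: Tannery over the coarse bonds; the step multiplier response converges -/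

section Lagrange

variable {N : ℕ}

/-- [folklore] Dilation by a nonzero factor is injective on the lattice. -/
theorem zsmul_lattice_injective (hN : (N : ℤ) ≠ 0) : Function.Injective fun y : Fin (d + 1) → ℤ => (N : ℤ) • y := by
  intro y y' h
  funext i
  have hi := congrFun h i
  simp only [Pi.smul_apply, smul_eq_mul] at hi
  exact mul_left_cancel₀ hN hi

/-- [folklore] **TANNERY FOR `S^Λ`**: coefficient families dominated by ONE weight decaying (fine units, rate `m > 0`) from the fine bond `u` as a function of the
coarse point `N•y`, converging for every coarse bond, over a sup-bounded kernel family `H` ⟹ `SLam N (c j) H κ u → SLam N c∞ H κ u` entrywise. -/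
theorem tendsto_SLam_apply [NeZero N] {c : ℕ → Fin (d + 1) → (Fin (d + 1) → ℤ) → Fin (d + 1) → (Fin (d + 1) → ℤ) → ℝ}
    {cinf : Fin (d + 1) → (Fin (d + 1) → ℤ) → Fin (d + 1) → (Fin (d + 1) → ℤ) → ℝ} {H : Fin (d + 1) → (Fin (d + 1) → ℤ) → MKer (d + 1) (Fib d)}
    {Cc CH m : ℝ} (hm : 0 < m) (κ : Fin (d + 1)) (u : Fin (d + 1) → ℤ)
    (hcb : ∀ j μ y, |c j μ y κ u| ≤ Cc * Real.exp (-m * l1 ((N : ℤ) • y - u)))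
    (hcl : ∀ μ y, Tendsto (fun j => c j μ y κ u) atTop (𝓝 (cinf μ y κ u)))
    (hH : ∀ μ y x z a b, |H μ y x z a b| ≤ CH) (x z : Fin (d + 1) → ℤ) (a b : Fib d) :
    Tendsto (fun j => SLam N (c j) H κ u x z a b) atTop (𝓝 (SLam N cinf H κ u x z a b)) := by
  simp only [SLam, cwsum_apply]
  refine Tendsto.neg (tendsto_finsetSum _ fun μ _ => ?_)
  have hN : (N : ℤ) ≠ 0 := by exact_mod_cast NeZero.ne N
  have hsum : Summable fun y : Fin (d + 1) → ℤ => Cc * Real.exp (-m * l1 ((N : ℤ) • y - u)) * CH :=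
    (((summable_exp_shift' (D := d + 1) hm u).comp_injective (zsmul_lattice_injective hN)).mul_left Cc).mul_right CH
  refine tendsto_tsum_of_dominated_convergence hsum (fun y => (hcl μ y).mul_const _) (Eventually.of_forall fun j y => ?_)
  rw [Real.norm_eq_abs, abs_mul]
  have hCH : 0 ≤ CH := (abs_nonneg _).trans (hH μ 0 x z a b)
  have hw : 0 ≤ Cc * Real.exp (-m * l1 ((N : ℤ) • y - u)) := (abs_nonneg _).trans (hcb j μ y)
  exact mul_le_mul (hcb j μ y) (hH μ y x z a b) (abs_nonneg _) hw

variable {Lc : ℕ} [NeZero Lc] {K₁ : MKer (d + 1) (Fib d)} {C cK m θ : ℝ}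

/-- [folklore] **UNIFORM DOMINATION OF THE STEP MULTIPLIER RESPONSE**: with `Decays (KStepUnit Lc j) C m` for every `j` (`0 < m`, `1 ≤ Lc`),
`|lamCoeffK (KStepUnit Lc (j+1)) (mmRead Lc (KStepUnit Lc j)) Lc μ y κ u| ≤ (|Fib d|·C²·Zl(m/2)) · e^{−(m/2)|Lc•y − u|₁}` (an2's `abs_lamCoeffK_le`, `decays_mmRead`). -/
theorem abs_lamCoeffK_KStepUnit_le (hLc : 1 ≤ Lc) (hK : ∀ j, Decays (KStepUnit (d := d) Lc j) C m) (hm : 0 < m) (j : ℕ) (μ : Fin (d + 1))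
    (y : Fin (d + 1) → ℤ) (κ : Fin (d + 1)) (u : Fin (d + 1) → ℤ) :
    |lamCoeffK (KStepUnit (d := d) Lc (j + 1)) (mmRead Lc (KStepUnit (d := d) Lc j)) Lc μ y κ u| ≤
      ((Fintype.card (Fib d) : ℝ) * (C * C) * Zl (d + 1) (m - m / 2)) * Real.exp (-(m / 2) * l1 ((Lc : ℤ) • y - u)) :=
  abs_lamCoeffK_le (hK (j + 1)) (decays_mmRead hLc (hK j) hm.le) hm Lc μ y κ u

/-- [folklore] **THE STEP MULTIPLIER RESPONSE CONVERGES ENTRYWISE**: `KStepUnit Lc j → K₁` at a geometric `Decays`-rate (uniform bound `C`, limit bound `C`) ⟹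
`lamCoeffK (KStepUnit Lc (j+1)) (mmRead Lc (KStepUnit Lc j)) Lc μ y κ u → lamCoeffK K₁ (mmRead Lc K₁) Lc μ y κ u` (`lamCoeffK A E = comp A E` read at one entry;
the owner's `LetterInheritance.tendsto_comp_of_rate`; `mmRead` is linear and keeps `Decays`). -/
theorem tendsto_lamCoeffK_KStepUnit (hLc : 1 ≤ Lc) (hK : ∀ j, Decays (KStepUnit (d := d) Lc j) C m) (hKinf : Decays K₁ C m)
    (hKrate : ∀ j, Decays (KStepUnit (d := d) Lc j - K₁) (cK * θ ^ j) m) (hm : 0 < m) (hθ0 : 0 ≤ θ) (hθ1 : θ < 1)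
    (μ : Fin (d + 1)) (y : Fin (d + 1) → ℤ) (κ : Fin (d + 1)) (u : Fin (d + 1) → ℤ) :
    Tendsto (fun j => lamCoeffK (KStepUnit (d := d) Lc (j + 1)) (mmRead Lc (KStepUnit (d := d) Lc j)) Lc μ y κ u) atTop
      (𝓝 (lamCoeffK K₁ (mmRead Lc K₁) Lc μ y κ u)) := by
  have hA : ∀ j, Decays (KStepUnit (d := d) Lc (j + 1)) C m := fun j => hK (j + 1)
  have hAr : ∀ j, Decays (KStepUnit (d := d) Lc (j + 1) - K₁) ((cK * θ) * θ ^ j) m := fun j =>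
    decays_congr_const (hKrate (j + 1)) (by rw [pow_succ]; ring)
  have hEinf : Decays (mmRead Lc K₁) C m := decays_mmRead hLc hKinf hm.le
  have hEr : ∀ j, Decays (mmRead Lc (KStepUnit (d := d) Lc j) - mmRead Lc K₁) (cK * θ ^ j) m := fun j => by
    rw [← mmRead_sub]; exact decays_mmRead hLc (hKrate j) hm.le
  exact tendsto_comp_of_rate hA hEinf hAr hEr hm hθ0 hθ1 ((Lc : ℤ) • y) u (Sum.inr μ) (Sum.inl κ)

end Lagrange

/-! ## §3 The fixed-point equation of the perfect action stencil -/

section FixedPoint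

variable {Lc : ℕ} [NeZero Lc]
  (V H : Fin (d + 1) → (Fin (d + 1) → ℤ) → MKer (d + 1) (Fib d)) (G : ℕ → MKer (d + 1) (Fib d)) (cE cVH cΛ : ℝ)

/-- [our object] **ROW N1-J∞-S — THE PERFECT ACTION STENCIL IS A FIXED POINT OF THE RESCALED RECURSION STEP.**  For the slotted recursion
`SrecOf V H G cE cVH cΛ` (an2) in the adopted units `S̃ j := unitS (sfStep Lc j) (smStep d Lc j) (SrecOf … j)`, under the DISPLAYED binders —
(ShV)(ShH) block shapes of the first-order tables, (LH₀) a sup bound on `H`; the G-slot `G̃ j := unitK_j (G j) → G∞` and the K-slot `KStepUnit Lc j → K₁` in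
`BiVertexLimit`'s rate currency (uniform `Decays` bound `C`, limit bound, geometric `Decays`-rate `cK θ^j`, rate `m`); the (CONV-C)-S rows `hS0` (uniform `LocStencil`)
and `hSall0` (geometric `LocStencil`-Cauchy data) of the END, at the common rate `m` and ratio `θ` (`0 < m`, `0 ≤ θ < 1`, `1 ≤ Lc`) — the constructed limit
`S∞ := limStOf S̃` satisfies
`S∞ = fun κ u ↦ (cE·Lc^{2(d+1)}) • e3OfK Lc G∞ S∞ κ u + cVH • V κ u + (cΛ·Lc^{2(d+1)}) • SLam Lc (lamCoeffK K₁ (mmRead Lc K₁) Lc) H κ u`,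
i.e. `S∞ = Φ_S(S∞; G∞, K₁, K₁)` with the `j`-free step map `Φ_S` of `PerfectStencilStep.unitS_SrecOf_succ`.  Proof: the entry of `S̃ (j+1)` tends to the entry of
`S∞` (rate data) AND — being `Φ_S(S̃ j; G̃ j, K̃ (j+1), K̃ j)` at that entry — to the entry of the right-hand side (§1–§2); limits are unique. -/
theorem limStOf_unitS_SrecOf_eq (hLc : 1 ≤ Lc)
    (hVff : ∀ κ u x y (α β : Fin (d + 1)), V κ u x y (Sum.inl α) (Sum.inl β) = 0)
    (hVmm : ∀ κ u x y (μ ν : Fin (d + 1)), V κ u x y (Sum.inr μ) (Sum.inr ν) = 0)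
    (hHfm : ∀ μ y x z (α ν : Fin (d + 1)), H μ y x z (Sum.inl α) (Sum.inr ν) = 0)
    (hHm : ∀ μ y x z (ν : Fin (d + 1)) (b : Fib d), H μ y x z (Sum.inr ν) b = 0)
    {CH : ℝ} (hHb : ∀ μ y x z a b, |H μ y x z a b| ≤ CH)
    {C cK Cs cS m θ : ℝ} (hm : 0 < m) (hθ0 : 0 ≤ θ) (hθ1 : θ < 1) {Ginf K₁ : MKer (d + 1) (Fib d)}
    (hG : ∀ j, Decays (unitK (sfStep Lc j) (smStep d Lc j) (G j)) C m) (hGinf : Decays Ginf C m)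
    (hGrate : ∀ j, Decays (unitK (sfStep Lc j) (smStep d Lc j) (G j) - Ginf) (cK * θ ^ j) m)
    (hK : ∀ j, Decays (KStepUnit (d := d) Lc j) C m) (hKinf : Decays K₁ C m)
    (hKrate : ∀ j, Decays (KStepUnit (d := d) Lc j - K₁) (cK * θ ^ j) m)
    (hS0 : ∀ j, LocStencil (unitS (sfStep Lc j) (smStep d Lc j) (SrecOf d Lc V H G cE cVH cΛ j)) Cs m)
    (hSall0 : ∀ k j, LocStencil (unitS (sfStep Lc (k + j)) (smStep d Lc (k + j)) (SrecOf d Lc V H G cE cVH cΛ (k + j)) -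
      unitS (sfStep Lc k) (smStep d Lc k) (SrecOf d Lc V H G cE cVH cΛ k)) (cS * θ ^ k) m) :
    limStOf (fun j => unitS (sfStep Lc j) (smStep d Lc j) (SrecOf d Lc V H G cE cVH cΛ j)) = fun κ u =>
      (cE * (Lc : ℝ) ^ (2 * (d + 1))) •
          e3OfK Lc Ginf (limStOf (fun j => unitS (sfStep Lc j) (smStep d Lc j) (SrecOf d Lc V H G cE cVH cΛ j))) κ u +
        cVH • V κ u +
        (cΛ * (Lc : ℝ) ^ (2 * (d + 1))) • SLam Lc (lamCoeffK K₁ (mmRead Lc K₁) Lc) H κ u := by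
  set St : ℕ → Fin (d + 1) → (Fin (d + 1) → ℤ) → MKer (d + 1) (Fib d) :=
    fun j => unitS (sfStep Lc j) (smStep d Lc j) (SrecOf d Lc V H G cE cVH cΛ j) with hSt
  have hSinf : LocStencil (limStOf St) Cs m := locStencil_limStOf (S := St) hS0 hSall0 hθ1
  have hSrate : ∀ k, LocStencil (St k - limStOf St) (cS * θ ^ k) m := locStencil_sub_limStOf (S := St) hSall0 hθ1
  funext κ u x z a b
  -- (1) the entry of `S̃ (j+1)` tends to the entry of `S∞`
  have h1 : Tendsto (fun j => St (j + 1) κ u x z a b) atTop (𝓝 (limStOf St κ u x z a b)) :=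
    (tendsto_of_biLoc_rate (T := fun k => St k κ u) (Tinf := limStOf St κ u)
      (fun k => by simpa only [Pi.sub_apply] using hSrate k κ u) hθ0 hθ1 x z a b).comp (tendsto_add_atTop_nat 1)
  -- (2) … and, through the `j`-free step, to the entry of the right-hand side
  have hE : Tendsto (fun j => e3OfK Lc (unitK (sfStep Lc j) (smStep d Lc j) (G j)) (St j) κ u x z a b) atTop
      (𝓝 (e3OfK Lc Ginf (limStOf St) κ u x z a b)) := by
    simp only [e3OfK_eq_e3K]
    exact tendsto_e3K_apply hG hGinf hGrate hS0 hSinf hSrate hm hθ0 hθ1 hLc κ u x z a b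
  have hΛ : Tendsto (fun j => SLam Lc (lamCoeffK (KStepUnit (d := d) Lc (j + 1)) (mmRead Lc (KStepUnit (d := d) Lc j)) Lc) H κ u x z a b) atTop
      (𝓝 (SLam Lc (lamCoeffK K₁ (mmRead Lc K₁) Lc) H κ u x z a b)) :=
    tendsto_SLam_apply (c := fun j => lamCoeffK (KStepUnit (d := d) Lc (j + 1)) (mmRead Lc (KStepUnit (d := d) Lc j)) Lc)
      (half_pos hm) κ u (fun j μ y => abs_lamCoeffK_KStepUnit_le hLc hK hm j μ y κ u)
      (fun μ y => tendsto_lamCoeffK_KStepUnit hLc hK hKinf hKrate hm hθ0 hθ1 μ y κ u) hHb x z a b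
  have hstep : ∀ j, St (j + 1) κ u x z a b =
      (cE * (Lc : ℝ) ^ (2 * (d + 1))) * e3OfK Lc (unitK (sfStep Lc j) (smStep d Lc j) (G j)) (St j) κ u x z a b + cVH * V κ u x z a b +
        (cΛ * (Lc : ℝ) ^ (2 * (d + 1))) *
          SLam Lc (lamCoeffK (KStepUnit (d := d) Lc (j + 1)) (mmRead Lc (KStepUnit (d := d) Lc j)) Lc) H κ u x z a b := fun j => by
    simp only [hSt]
    rw [unitS_SrecOf_succ V H G cE cVH cΛ hVff hVmm hHfm hHm j]
    simp only [Pi.add_apply, Pi.smul_apply, smul_eq_mul]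
  have h2 : Tendsto (fun j => St (j + 1) κ u x z a b) atTop
      (𝓝 ((cE * (Lc : ℝ) ^ (2 * (d + 1))) * e3OfK Lc Ginf (limStOf St) κ u x z a b + cVH * V κ u x z a b +
        (cΛ * (Lc : ℝ) ^ (2 * (d + 1))) * SLam Lc (lamCoeffK K₁ (mmRead Lc K₁) Lc) H κ u x z a b)) := by
    rw [show (fun j => St (j + 1) κ u x z a b) = fun j =>
        (cE * (Lc : ℝ) ^ (2 * (d + 1))) * e3OfK Lc (unitK (sfStep Lc j) (smStep d Lc j) (G j)) (St j) κ u x z a b + cVH * V κ u x z a b +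
          (cΛ * (Lc : ℝ) ^ (2 * (d + 1))) *
            SLam Lc (lamCoeffK (KStepUnit (d := d) Lc (j + 1)) (mmRead Lc (KStepUnit (d := d) Lc j)) Lc) H κ u x z a b from funext hstep]
    exact ((hE.const_mul _).add tendsto_const_nhds).add (hΛ.const_mul _)
  have h := tendsto_nhds_unique h1 h2
  simpa only [Pi.add_apply, Pi.smul_apply, smul_eq_mul] using h

end FixedPoint

end Summit.QuantumFields.BalabanUV.Beta.FP.PerfectStencilFixedPoint

end
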